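import Mathlib
import Literature.Analysis.Complex.HolomorphicParametricIntegral

/-!
# Route `FilamentSkeletonRss` · child crux `TangentSkeletonNearStraightL` (stmt-NavierStokesRegularity-23320) · registered line
# `child_tangent_analytic_strip_L` (b0b56c52900dd90a), stub `stub_stripPropagation` — brick: HOLOMORPHY OF INTERVAL INTEGRALS WITH CONTINUOUS KERNEL

R2 of the STUB-PLAN memo attached to 23320, in the form the near-diagonal piece needs: the tree's holomorphic dominated-integral lemma
(`Literature.Analysis.Complex.HolomorphicParametricIntegral.differentiableOn_integral_of_dominated`) specialised to a kernel `K : ℂ → ℝ → G` that is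
JOINTLY CONTINUOUS on `V × [a, b]` (`V` open) and holomorphic in `z ∈ V` for each `s ∈ [a, b]`: then `z ↦ ∫_a^b K(z, s) ds` is holomorphic on `V`
(`differentiableOn_intervalIntegral_of_continuousOn`; the domination is the sup on `closedBall × [a,b]`, a compact set).  The complexified
near-diagonal matched integrand (`Theorems.StadiumKernelPieces`, `Theorems.StadiumChord`, `Theorems.StadiumNearKernelBound`) is such a kernel.
HONEST FRAMING: a complex-analysis brick for a plan about a HYPOTHETICAL filament skeleton on the NEGATIVE side of a MODEL route; the stub
`stub_stripPropagation` is NOT closed; nothing here bears on Navier–Stokes regularity or blow-up.  `--supports stmt-NavierStokesRegularity-23320`.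
-/

set_option linter.dupNamespace false

noncomputable section

namespace Summit.NavierStokesRegularity.NavierStokesRegularity.Theorems.StadiumHolomorphicIntegral

open Set MeasureTheory Metric Filter Topology

variable {G : Type*} [NormedAddCommGroup G] [NormedSpace ℂ G]

/-- **Set-integral form.**  `K : ℂ → ℝ → G` jointly continuous on `V ×ˢ [[a, b]]` (`V` open) and holomorphic in the first variable on `V` for each
`s ∈ [[a, b]]`: `z ↦ ∫_{Ι a b} K(z, s) ds` is holomorphic on `V`. [folklore] -/
theorem differentiableOn_setIntegral_uIoc_of_continuousOn {V : Set ℂ} (hV : IsOpen V) {a b : ℝ} {K : ℂ → ℝ → G}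
    (hK : ContinuousOn (Function.uncurry K) (V ×ˢ Set.uIcc a b))
    (hKd : ∀ s ∈ Set.uIcc a b, DifferentiableOn ℂ (fun z => K z s) V) :
    DifferentiableOn ℂ (fun z => ∫ s in Set.uIoc a b, K z s) V := by
  -- continuity of each slice
  have hslice : ∀ z ∈ V, ContinuousOn (K z) (Set.uIcc a b) := by
    intro z hz
    have h1 : ContinuousOn (fun s : ℝ => (z, s)) (Set.uIcc a b) := (Continuous.prodMk_right z).continuousOn
    exact hK.comp h1 fun s hs => ⟨hz, hs⟩
  refine Literature.Analysis.Complex.differentiableOn_integral_of_dominated (μ := volume.restrict (Set.uIoc a b)) ?_ ?_ ?_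
  · intro z hz
    exact ((hslice z hz).mono uIoc_subset_uIcc).aestronglyMeasurable measurableSet_uIoc
  · exact ae_restrict_of_forall_mem measurableSet_uIoc fun s hs => hKd s (uIoc_subset_uIcc hs)
  · intro x₀ hx₀
    obtain ⟨r, hr, hrV⟩ := Metric.isOpen_iff.1 hV x₀ hx₀
    -- a closed ball of half the radius inside `V`
    have hcb : closedBall x₀ (r / 2) ⊆ V := fun p hp => hrV (lt_of_le_of_lt (mem_closedBall.1 hp) (by linarith))
    have hcpt : IsCompact (closedBall x₀ (r / 2) ×ˢ Set.uIcc a b) := (isCompact_closedBall _ _).prod isCompact_uIcc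
    obtain ⟨C, hC⟩ := hcpt.exists_bound_of_continuousOn (hK.mono (prod_mono hcb le_rfl))
    refine ⟨r / 2, by linarith, fun p hp => hcb (ball_subset_closedBall hp), fun _ => C, ?_, ?_⟩
    · have hfin : volume (Set.uIoc a b) ≠ ⊤ := by
        rw [Set.uIoc, Real.volume_Ioc]; exact ENNReal.ofReal_ne_top
      exact integrableOn_const hfin
    · refine ae_restrict_of_forall_mem measurableSet_uIoc fun s hs p hp => ?_
      exact hC (p, s) ⟨ball_subset_closedBall hp, uIoc_subset_uIcc hs⟩

/-- **Holomorphy of interval integrals with a jointly continuous, separately holomorphic kernel.**  `K : ℂ → ℝ → G` jointly continuous on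
`V ×ˢ [[a, b]]` (`V` open), `K(·, s)` holomorphic on `V` for each `s ∈ [[a, b]]`: then `z ↦ ∫_a^b K(z, s) ds` is holomorphic on `V`. [folklore] -/
theorem differentiableOn_intervalIntegral_of_continuousOn {V : Set ℂ} (hV : IsOpen V) {a b : ℝ} {K : ℂ → ℝ → G}
    (hK : ContinuousOn (Function.uncurry K) (V ×ˢ Set.uIcc a b))
    (hKd : ∀ s ∈ Set.uIcc a b, DifferentiableOn ℂ (fun z => K z s) V) :
    DifferentiableOn ℂ (fun z => ∫ s in a..b, K z s) V := by
  have h := differentiableOn_setIntegral_uIoc_of_continuousOn hV hK hKd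
  have heq : (fun z => ∫ s in a..b, K z s) = fun z => (if a ≤ b then (1:ℝ) else -1) • ∫ s in Set.uIoc a b, K z s := by
    funext z
    exact intervalIntegral.intervalIntegral_eq_integral_uIoc (K z) a b volume
  rw [heq]
  exact h.const_smul _

end Summit.NavierStokesRegularity.NavierStokesRegularity.Theorems.StadiumHolomorphicIntegral

end
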